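import Literature.MathematicalPhysics.QuantumLattice.SectorPropagatorGram
import Literature.MathematicalPhysics.QuantumLattice.FermionicTreeExpansionBounds
import HarnessLib

/-!
# Sector fields in Gram form: `G = δ_{ω,ω'} δ_{σ,σ'} g^{(h)}_ω(x - y) = ⟪𝔄, 𝔅⟫` (BGM 2006 (2.66)–(2.67a))

Topic `Literature/MathematicalPhysics/QuantumLattice`; glue between the continuum Gram form of the
sector propagators (`SectorPropagatorGram`: `⟪A_x, B_y⟫_{L²} = g^{(h)}_ω(x - y)`,
`‖A_x‖², ‖B_y‖² ≤ 128 B₁B₂`) and the abstract fermionic tree-expansion bounds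
(`FermionicTreeExpansionBounds`: propagators `gramProp 𝕜 A B = [⟪A f, B f'⟫]` in ANY inner product
space, bounded through Gram–Hadamard by products of `‖A f‖ ‖B f'‖`). Benfatto–Giuliani–Mastropietro
2006, (2.66)–(2.67a): the propagator matrix of the sector fields is
`G^{h,T}_{ij,i'j'} = t_{i,i'} δ_{ω⁻,ω⁺} δ_{σ⁻,σ⁺} g^{(h)}_{ω}(x_{ij} - y_{i'j'})`; the Kronecker deltas
in the sector and spin labels are realised, as in BGM 2003 (3.50a) ("`ℋ = ℝ^{|O_h|} ⊗ ℝ^s ⊗ L²(ℝ³)`"),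
by tensoring with orthonormal label vectors. PROVED:

* `sectorSpinUnit n ω σ` — the unit label vector `e_{(ω,σ)} ∈ ℝ^{2·2^{n+1}}`, orthonormal;
* `sectorFieldA`, `sectorFieldB` — `𝔄 = e_{(ω,σ)} ⊗ A_x`, `𝔅 = e_{(ω',σ')} ⊗ B_y` in
  `ℓ²(labels; L²(ℝ × ℝ²))`;
* **`inner_sectorFieldA_sectorFieldB`** — `⟪𝔄, 𝔅⟫ = δ_{ω,ω'} δ_{σ,σ'} g^{(h)}_ω(x - y)`;
* `norm_sectorFieldA_le`, `norm_sectorFieldB_le` — `‖𝔄‖, ‖𝔅‖ ≤ √(128 B₁(n) B₂(n))` (each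
  `O(γ^{(3/4)h})`), the per-field factors entering `FermionicTree.assignBound`.

Everything is PROVED; the definitions are the label vector and the two fields.

## Sources

* G. Benfatto, A. Giuliani, V. Mastropietro, Ann. Henri Poincaré 7 (2006) 809–898, §2.6
  (2.66)–(2.67a), (2.80). [BenfattoGiulianiMastropietro2006]
* G. Benfatto, A. Giuliani, V. Mastropietro, Ann. Henri Poincaré 4 (2003) 137–193, §3 (3.50a).
  [BenfattoGiulianiMastropietro2003]
-/

noncomputable section

open Real MeasureTheory
open scoped InnerProductSpace

namespace Literature.MathematicalPhysics.QuantumLattice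

/-! ### Orthonormal sector–spin labels -/

/-- The label index of `(ω, σ)`, `ω < 2^{n+1}`, `σ ∈ {↑, ↓}`. [folklore] -/
def sectorSpinIndex (n : ℕ) (ω : Fin (sectorCount n)) (σ : Fin 2) : Fin (sectorCount n * 2) :=
  finProdFinEquiv (ω, σ)

/-- The unit label vector `e_{(ω,σ)}`. [cite: BenfattoGiulianiMastropietro2003, §3 (3.50a)] -/
def sectorSpinUnit (n : ℕ) (ω : Fin (sectorCount n)) (σ : Fin 2) : EuclideanSpace ℝ (Fin (sectorCount n * 2)) :=
  EuclideanSpace.single (sectorSpinIndex n ω σ) 1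

/-- The labels are injective. [folklore] -/
theorem sectorSpinIndex_eq_iff (n : ℕ) (ω ω' : Fin (sectorCount n)) (σ σ' : Fin 2) :
    sectorSpinIndex n ω σ = sectorSpinIndex n ω' σ' ↔ ω = ω' ∧ σ = σ' := by
  rw [sectorSpinIndex, sectorSpinIndex, finProdFinEquiv.apply_eq_iff_eq, Prod.mk.injEq]

/-- **Orthonormality of the labels**: `⟪e_{(ω,σ)}, e_{(ω',σ')}⟫ = δ_{ω,ω'} δ_{σ,σ'}`. [folklore] -/
theorem inner_sectorSpinUnit (n : ℕ) (ω ω' : Fin (sectorCount n)) (σ σ' : Fin 2) :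
    ⟪sectorSpinUnit n ω σ, sectorSpinUnit n ω' σ'⟫_ℝ = if ω = ω' ∧ σ = σ' then 1 else 0 := by
  by_cases h : ω = ω' ∧ σ = σ'
  · obtain ⟨rfl, rfl⟩ := h
    simp [sectorSpinUnit]
  · have hne : sectorSpinIndex n ω σ ≠ sectorSpinIndex n ω' σ' := fun e => h ((sectorSpinIndex_eq_iff n ω ω' σ σ').1 e)
    rw [if_neg h]
    simp [sectorSpinUnit, EuclideanSpace.inner_single_left, hne]

/-- `‖e_{(ω,σ)}‖ = 1`. [folklore] -/
theorem norm_sectorSpinUnit (n : ℕ) (ω : Fin (sectorCount n)) (σ : Fin 2) : ‖sectorSpinUnit n ω σ‖ = 1 := by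
  simp [sectorSpinUnit]

/-! ### The sector fields -/

section Fields

variable {μ : ℝ} (hμ₁ : -4 < μ) (hμ₂ : μ < -2 - Real.sqrt 2)
include hμ₁ hμ₂

/-- **The annihilation-side sector field** `𝔄 = e_{(ω,σ)} ⊗ A_x ∈ ℓ²(labels; L²(ℝ × ℝ²))`. [cite: BenfattoGiulianiMastropietro2006, §2.6 (2.66)] -/
def sectorFieldA {e₀ : ℝ} (he : 0 < e₀) (he' : e₀ ≤ (4 + μ) / 2) (n : ℕ) (ω : Fin (sectorCount n)) (σ : Fin 2)
    (x₀ : ℝ) (x : Fin 2 → ℝ) : PiLp 2 (fun _ : Fin (sectorCount n * 2) => Lp ℂ 2 (volume : Measure (ℝ × (Fin 2 → ℝ)))) :=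
  FermionicTree.tens ℂ (sectorSpinUnit n ω σ) (sectorGramA hμ₁ hμ₂ he he' n (ω : ℕ) x₀ x)

/-- **The creation-side sector field** `𝔅 = e_{(ω',σ')} ⊗ B_y`. [cite: BenfattoGiulianiMastropietro2006, §2.6 (2.66)] -/
def sectorFieldB {e₀ : ℝ} (he : 0 < e₀) (he' : e₀ ≤ (4 + μ) / 2) (n : ℕ) (ω : Fin (sectorCount n)) (σ : Fin 2)
    (y₀ : ℝ) (y : Fin 2 → ℝ) : PiLp 2 (fun _ : Fin (sectorCount n * 2) => Lp ℂ 2 (volume : Measure (ℝ × (Fin 2 → ℝ)))) :=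
  FermionicTree.tens ℂ (sectorSpinUnit n ω σ) (sectorGramB hμ₁ hμ₂ he he' n (ω : ℕ) y₀ y)

/-- **The propagator matrix of the sector fields is a Gram matrix** (BGM 2006 (2.66)–(2.67a)):
`⟪𝔄_{ω,σ,x}, 𝔅_{ω',σ',y}⟫ = δ_{ω,ω'} δ_{σ,σ'} g^{(h)}_ω(x - y)`. [cite: BenfattoGiulianiMastropietro2006, §2.6 (2.66)–(2.67a)] -/
theorem inner_sectorFieldA_sectorFieldB {e₀ : ℝ} (he : 0 < e₀) (he' : e₀ ≤ (4 + μ) / 2) (n : ℕ)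
    (ω ω' : Fin (sectorCount n)) (σ σ' : Fin 2) (x₀ y₀ : ℝ) (x y : Fin 2 → ℝ) :
    ⟪sectorFieldA hμ₁ hμ₂ he he' n ω σ x₀ x, sectorFieldB hμ₁ hμ₂ he he' n ω' σ' y₀ y⟫_ℂ =
      if ω = ω' ∧ σ = σ' then sectorPropagator e₀ μ n ω (x₀ - y₀) (x - y) else 0 := by
  rw [sectorFieldA, sectorFieldB, FermionicTree.inner_tens, inner_sectorSpinUnit]
  split_ifs with h
  · rw [← h.1, inner_sectorGramA_sectorGramB]; simp
  · simp

/-- **`‖𝔄‖ ≤ √(128 B₁(n) B₂(n))`** (`= O(γ^{(3/4)h})`). [cite: BenfattoGiulianiMastropietro2006, §2.6 (2.80)] -/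
theorem norm_sectorFieldA_le {e₀ : ℝ} (he : 0 < e₀) (he' : e₀ ≤ (4 + μ) / 2) (n : ℕ) (ω : Fin (sectorCount n)) (σ : Fin 2)
    (x₀ : ℝ) (x : Fin 2 → ℝ) :
    ‖sectorFieldA hμ₁ hμ₂ he he' n ω σ x₀ x‖ ≤ Real.sqrt (128 * (normalExtent μ e₀ n * tangentExtent μ e₀ n)) := by
  rw [sectorFieldA, FermionicTree.norm_tens, norm_sectorSpinUnit, one_mul]
  exact Real.le_sqrt_of_sq_le (norm_sq_sectorGramA_le hμ₁ hμ₂ he he' n ω x₀ x)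

/-- **`‖𝔅‖ ≤ √(128 B₁(n) B₂(n))`.** [cite: BenfattoGiulianiMastropietro2006, §2.6 (2.80)] -/
theorem norm_sectorFieldB_le {e₀ : ℝ} (he : 0 < e₀) (he' : e₀ ≤ (4 + μ) / 2) (n : ℕ) (ω : Fin (sectorCount n)) (σ : Fin 2)
    (y₀ : ℝ) (y : Fin 2 → ℝ) :
    ‖sectorFieldB hμ₁ hμ₂ he he' n ω σ y₀ y‖ ≤ Real.sqrt (128 * (normalExtent μ e₀ n * tangentExtent μ e₀ n)) := by
  rw [sectorFieldB, FermionicTree.norm_tens, norm_sectorSpinUnit, one_mul]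
  exact Real.le_sqrt_of_sq_le (norm_sq_sectorGramB_le hμ₁ hμ₂ he he' n ω y₀ y)

/-- Hence every entry of the propagator matrix is bounded by `128 B₁(n) B₂(n)` and, by Gram–Hadamard
(`Literature.Analysis.InnerProduct.norm_det_inner_le_prod_norm_mul_prod_norm`), every `m × m` minor
by `(128 B₁(n) B₂(n))^m` — BGM 2006 (2.80) at the level of a single cluster. [cite: BenfattoGiulianiMastropietro2006, §2.6 (2.80)] -/
theorem norm_det_sectorField_le {e₀ : ℝ} (he : 0 < e₀) (he' : e₀ ≤ (4 + μ) / 2) (n : ℕ) {m : ℕ}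
    (ω ω' : Fin m → Fin (sectorCount n)) (σ σ' : Fin m → Fin 2) (x₀ y₀ : Fin m → ℝ) (x y : Fin m → Fin 2 → ℝ) :
    ‖(Matrix.of fun i j => ⟪sectorFieldA hμ₁ hμ₂ he he' n (ω i) (σ i) (x₀ i) (x i),
        sectorFieldB hμ₁ hμ₂ he he' n (ω' j) (σ' j) (y₀ j) (y j)⟫_ℂ).det‖ ≤
      (128 * (normalExtent μ e₀ n * tangentExtent μ e₀ n)) ^ m := by
  refine (Literature.Analysis.InnerProduct.norm_det_inner_le_prod_norm_mul_prod_norm _ _).trans ?_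
  have hA : ∏ i, ‖sectorFieldA hμ₁ hμ₂ he he' n (ω i) (σ i) (x₀ i) (x i)‖ ≤
      ∏ _i : Fin m, Real.sqrt (128 * (normalExtent μ e₀ n * tangentExtent μ e₀ n)) :=
    Finset.prod_le_prod (fun i _ => norm_nonneg _) fun i _ => norm_sectorFieldA_le hμ₁ hμ₂ he he' n _ _ _ _
  have hB : ∏ j, ‖sectorFieldB hμ₁ hμ₂ he he' n (ω' j) (σ' j) (y₀ j) (y j)‖ ≤
      ∏ _j : Fin m, Real.sqrt (128 * (normalExtent μ e₀ n * tangentExtent μ e₀ n)) :=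
    Finset.prod_le_prod (fun j _ => norm_nonneg _) fun j _ => norm_sectorFieldB_le hμ₁ hμ₂ he he' n _ _ _ _
  refine (mul_le_mul hA hB (Finset.prod_nonneg fun _ _ => norm_nonneg _)
    (Finset.prod_nonneg fun _ _ => Real.sqrt_nonneg _)).trans (le_of_eq ?_)
  have h0 : (0 : ℝ) ≤ 128 * (normalExtent μ e₀ n * tangentExtent μ e₀ n) :=
    mul_nonneg (by norm_num) (mul_nonneg (normalExtent_nonneg hμ₁ hμ₂ he n) (tangentExtent_nonneg hμ₁ he n))
  rw [Finset.prod_const, Finset.card_univ, Fintype.card_fin, ← mul_pow, Real.mul_self_sqrt h0]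

end Fields

end Literature.MathematicalPhysics.QuantumLattice

end
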